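import Mathlib.NumberTheory.Bertrand
import Literature.Computability.Cryptography.OneWayFunctions
import HarnessLib
import HarnessLib.Audit

set_option linter.dupNamespace false -- D-0017: single-problem summit ⇒ `QuantumAdvantage.QuantumAdvantage` by design

/-!
# The factoring assumption (average case, two random primes of equal length) — conjecture obligation

Summit-side OBLIGATION file (gate ruling `literature.conjecture`: an unproven conjecture is filed under
`Summits/<S>/<Sub>/Theorems/<Name>.lean` as `@[conjecture] def … : Prop` and referenced by name; the
route using it takes it as a crux / conditional bridge). Consumer: the conditional reduction
`FactoringAssumption → WbwThesis` of crux `stmt-QuantumAdvantage-2238` (route `WhiteBoxWalk`, line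
`Sketch`; objects in `WhiteBoxWalkDefs.lean`).

The standard intractability ASSUMPTION of factoring-based cryptography, in Goldreich's formulation
(*Foundations of Cryptography I*, 2001, §2.2.4.1 "Integer factorization": "it is widely believed
that ... given the product of two uniformly chosen primes [of length `n`] it is infeasible to find
the prime factors"; Katz–Lindell, *Introduction to Modern Cryptography* (2nd ed. 2014), §8.2.3,
"the factoring assumption" relative to a modulus generator `GenModulus` that outputs the product of
two random `n`-bit primes): every probabilistic polynomial-time algorithm, given `(1ᵐ, P · Q)` for
independent uniformly random `m`-bit primes `P, Q`, outputs a prime factor with probability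
negligible in `m`.

* `mbitPrimes m` — the `m`-bit primes, `{p prime | 2^{m-1} ≤ p < 2^m}` (nonempty for `m ≥ 2`,
  `mbitPrimes_nonempty`, Bertrand's postulate);
* `primePairAvg m g` — the average of `g p q` over independent uniform `m`-bit primes;
* `FactoringAssumption` — the OPEN CONJECTURE (registered `@[conjecture]`, CONVENTIONS §4: used only
  as a hypothesis `(h : FactoringAssumption)`; no `_holds` is expected — a proof would give
  `WeakOWFExist` and hence `P ≠ NP` inside the tree, and the statement is false against quantum
  polynomial time by Shor's theorem `factoring_mem_FBQP_holds`).

Conventions are those of `OneWayFunctions.lean`: adversaries are `RandAlg (List Bool) (List Bool)`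
with `IsPPT A id`, the input is `boolPair (unaryEncodeNat m) (encodeNat (P*Q))` (Goldreich's
auxiliary `1ᵐ`), success is the PREFIX event "the output starts with `encodeNat (min P Q)`" (the
output convention of the tree's search classes, e.g. `FBQP`; asking for the smaller factor makes
the success event a single prefix set and is equivalent to asking for either factor), and
negligibility is Mathlib's `SuperpolynomialDecay atTop (fun m : ℕ => (m : ℝ))`.

## References

* O. Goldreich, *Foundations of Cryptography I: Basic Tools*, CUP 2001, §2.2.4.1 (integer
  factorization as a candidate one-way function; the factoring assumption), §2.2.1 (conventions).
* J. Katz, Y. Lindell, *Introduction to Modern Cryptography*, 2nd ed., CRC 2014, §8.2.3 (the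
  factoring assumption, `GenModulus`).
-/

namespace Summit.QuantumAdvantage.QuantumAdvantage.Theorems

open Literature.Computability.Cryptography Literature.Computability.Complexity
open Filter Asymptotics _root_.Computability Finset

/-- The `m`-bit primes: primes `p` with `2^{m-1} ≤ p < 2^m`. [Goldreich 2001, §2.2.4.1 ("uniformly
chosen primes of length `n`")] [cite: Goldreich2001, §2.2.4.1] -/
def mbitPrimes (m : ℕ) : Finset ℕ := (Finset.Ico (2 ^ (m - 1)) (2 ^ m)).filter Nat.Prime

/-- Membership in `mbitPrimes`. [cite: Goldreich2001, §2.2.4.1] -/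
theorem mem_mbitPrimes {m p : ℕ} : p ∈ mbitPrimes m ↔ p.Prime ∧ 2 ^ (m - 1) ≤ p ∧ p < 2 ^ m := by
  simp only [mbitPrimes, mem_filter, mem_Ico]
  tauto

/-- For `m ≥ 2` there is an `m`-bit prime (Bertrand's postulate between `2^{m-1}` and `2^m`).
[cite: Goldreich2001, §2.2.4.1] -/
theorem mbitPrimes_nonempty {m : ℕ} (hm : 2 ≤ m) : (mbitPrimes m).Nonempty := by
  obtain ⟨k, rfl⟩ := Nat.exists_eq_add_of_le hm
  have hpos : (2 : ℕ) ^ (2 + k - 1) ≠ 0 := by positivity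
  obtain ⟨p, hp, hlt, hle⟩ := Nat.exists_prime_lt_and_le_two_mul (2 ^ (2 + k - 1)) hpos
  refine ⟨p, mem_mbitPrimes.2 ⟨hp, hlt.le, ?_⟩⟩
  have h2 : 2 * 2 ^ (2 + k - 1) = 2 ^ (2 + k) := by
    rw [← pow_succ']; congr 1; omega
  rw [h2] at hle
  rcases hle.lt_or_eq with h | h
  · exact h
  · exfalso
    have h4 : (2 : ℕ) ^ (2 + k) = 4 * 2 ^ k := by rw [pow_add]; norm_num
    have : (2 : ℕ) ∣ p := ⟨2 * 2 ^ k, by rw [h, h4]; ring⟩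
    have := (Nat.prime_dvd_prime_iff_eq Nat.prime_two hp).1 this
    subst this
    have : (4 : ℕ) ≤ 2 := by
      calc (4 : ℕ) ≤ 4 * 2 ^ k := Nat.le_mul_of_pos_right _ (by positivity)
        _ = 2 := by rw [← h4, ← h]
    omega

/-- `primePairAvg m g`: the average of `g p q` over INDEPENDENT uniformly random `m`-bit primes `p, q`
(`0` when there are none, i.e. `m ≤ 1`). [cite: Goldreich2001, §2.2.4.1] -/
noncomputable def primePairAvg (m : ℕ) (g : ℕ → ℕ → ℝ) : ℝ :=
  (∑ p ∈ mbitPrimes m, ∑ q ∈ mbitPrimes m, g p q) / ((mbitPrimes m).card : ℝ) ^ 2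

/-- The average of a nonnegative function is nonnegative. [cite: Goldreich2001, §2.2.4.1] -/
theorem primePairAvg_nonneg {m : ℕ} {g : ℕ → ℕ → ℝ} (hg : ∀ p q, 0 ≤ g p q) : 0 ≤ primePairAvg m g :=
  div_nonneg (sum_nonneg fun p _ => sum_nonneg fun q _ => hg p q) (by positivity)

/-- The average of a function bounded by `1` is at most `1`. [cite: Goldreich2001, §2.2.4.1] -/
theorem primePairAvg_le_one {m : ℕ} {g : ℕ → ℕ → ℝ} (hg : ∀ p q, g p q ≤ 1) : primePairAvg m g ≤ 1 := by
  unfold primePairAvg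
  rcases Nat.eq_zero_or_pos (mbitPrimes m).card with h | h
  · have he : mbitPrimes m = ∅ := card_eq_zero.1 h
    simp [he]
  · rw [div_le_one (by positivity), sq]
    calc ∑ p ∈ mbitPrimes m, ∑ q ∈ mbitPrimes m, g p q ≤ ∑ _p ∈ mbitPrimes m, ∑ _q ∈ mbitPrimes m, (1 : ℝ) :=
          sum_le_sum fun p _ => sum_le_sum fun q _ => hg p q
      _ = ((mbitPrimes m).card : ℝ) * (mbitPrimes m).card := by simp

/-- OPEN CONJECTURE — **the factoring assumption** (average case, two uniformly random primes of
equal length), POSED as an intractability assumption in O. Goldreich, *Foundations of Cryptography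
I*, CUP 2001, §2.2.4.1 "Integer factorization" (the belief that it is infeasible to retrieve the
primes from the product of two uniformly chosen primes of length `n`; the source of the candidate
one-way function `f_mult`) and, as "the factoring assumption" relative to a modulus generator, in
Katz–Lindell, *Introduction to Modern Cryptography*, 2nd ed. 2014, §8.2.3. [status: open]
Statement: for every probabilistic polynomial-time `A`, the probability that `A`, given
`(1ᵐ, P·Q)` for independent uniformly random `m`-bit primes `P, Q`, outputs (a string beginning
with the code of) the smaller prime factor `min P Q`, is negligible in `m`.

Status: open — neither a proof nor a refutation (classically) is in print or in the tree. It implies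
`WeakOWFExist` (Goldreich, loc. cit.: `f_mult` is weakly one-way under it; in the tree via the
prime-pair function `fPQ` of `WhiteBoxWalkDefs.lean`) and hence
`P ≠ NP` (`pneNP_shape_of_WeakOWFExist`), so no `FactoringAssumption_holds` is expected; it is FALSE
against quantum polynomial time (Shor 1997, the tree's `factoring_mem_FBQP_holds`), which is why it
feeds the quantum-advantage thesis `WbwThesis`. Registered as an open statement (CONVENTIONS §4: open
conjectures stay `def … : Prop` and are used only as hypotheses `(h : FactoringAssumption)`).
[cite: Goldreich2001, §2.2.4.1 (integer factorization; the factoring assumption)] -/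
@[conjecture] def FactoringAssumption : Prop :=
  ∀ A : RandAlg (List Bool) (List Bool), IsPPT A id →
    SuperpolynomialDecay atTop (fun m : ℕ => (m : ℝ)) fun m =>
      primePairAvg m fun p q =>
        A.pr id (boolPair (unaryEncodeNat m) (encodeNat (p * q))) {y | encodeNat (min p q) <+: y}

/-- Unfolding of `FactoringAssumption` (by `Iff.rfl`). [cite: Goldreich2001, §2.2.4.1] -/
theorem factoringAssumption_iff :
    FactoringAssumption ↔ ∀ A : RandAlg (List Bool) (List Bool), IsPPT A id →
      SuperpolynomialDecay atTop (fun m : ℕ => (m : ℝ)) fun m =>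
        primePairAvg m fun p q =>
          A.pr id (boolPair (unaryEncodeNat m) (encodeNat (p * q))) {y | encodeNat (min p q) <+: y} :=
  Iff.rfl

end Summit.QuantumAdvantage.QuantumAdvantage.Theorems
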